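import Mathlib
import Literature.NumberTheory.LFunctions.Zhang2022.Section16I3plusShift
import Literature.NumberTheory.LFunctions.Zhang2022.Section4Prop22Eventually
import HarnessLib

/-!
# Zhang (2022) §16 p. 89, step `Z22:§16.u010`: `Φ₂ = Θ₂(β₁,𝐤₂*,𝐚₂*) + o(𝔓)` assembled from the
# residue step u002, `I₃⁻(ψ) ≪ ε` (u004) and the move `𝔍(α) → 𝔍(1)`

Topic `Literature/NumberTheory/LFunctions/Zhang2022` (Landau–Siegel audit tree; verdict-neutral).
Y. Zhang, *Discrete mean estimates and the Landau–Siegel zero*, arXiv:2211.02515v1 (2022)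
[Zhang2022LandauSiegel] — **an unrefereed manuscript under adjudication; nothing in this file asserts or
denies its Theorems 1–2.** ZHANG-L discharge lane (WP16), leaf `Typed.Section16A.Step16_u010 c′` of
`Skeleton.theorem1_of_leaves_v19` (node `Z22:§16.u010`, §16 p. 89, tex L4445):

> u002 "Similar to (15.3), `Φ₂ = Σ_{ψ∈Ψ₁}(p_ψt₀)^{β₁}(I₃⁺(ψ) − I₃⁻(ψ)) + O(ε)`."
> u004 "For `ψ ∈ Ψ₁`, moving the segment `𝔍(−α)` to `𝔍(−𝓛⁹)` we obtain … `I₃⁻(ψ) ≪ ε`."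
> u005 "Hence `Φ₂ = Σ_{ψ∈Ψ₁}(p_ψt₀)^{β₁}I₃⁺(ψ) + O(ε)`."
> (16.1)/u010 "… we can move the segment `𝔍(α)` to `𝔍(1)` … We can rewrite (16.1) as
> `Φ₂ = Θ₂(β₁,𝐤₂*,𝐚₂*) + o(p)`."

This file is the BOOKKEEPING of that chain (kernel edges; the analytic inputs are tree theorems or the
typed nodes by name):

* `step16_u005_of : Step16_u002 c′ → Step16_u004 c′ → Step16_u005 c′` — u005 from u002 + u004
  (`#Ψ₁ ≤ 𝔓 ≤ 4P² = 4e^{2𝓛⁹}` against `e^{−c𝓛¹⁰}`, `|(p_ψt₀)^{β₁}| = 1`);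
* `step16_u010_of_u005 : Prop22i → Step16_u005 c′ → Step16_u010 c′` — u010 from u005 + the move
  `𝔍(α) → 𝔍(1)` and the rewriting as `Θ₂` (tree: `Step16u010.sum_I3plus_sub_Theta2_le_of`,
  `Section16I3plusShift`; `Section16I3plusTheta2`), the `O(ε)` absorbed in `o(𝔓)` by `𝔓 ≥ 1`;
* `step16_u010_of_parts : Prop22i → Step16_u002 c′ → Step16_u004 c′ → Step16_u010 c′`, and with the
  tree's `Skeleton.prop22i_holds` (Proposition 2.2 (i), `Section4Prop22Eventually`):
  **`step16_u010_of : Step16_u002 c′ → Step16_u004 c′ → Step16_u010 c′`** — the leaf modulo its two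
  residual displayed steps u002 (residue theorem, the §16 twin of (8.1)/(15.3)) and u004.

Theorems only; no definitions, no named facts; axioms standard. WHAT THIS IS NOT: proofs of u002/u004
(separate files of the lane), of (16.1) with its `Ψ₁ → Ψ` extension (not needed: `Θ₂` sums over `Ψ₁`),
or any claim about Theorems 1–2 of the source or about Landau–Siegel zeros.

## References

* Y. Zhang, arXiv:2211.02515v1 (2022), §16 pp. 88–89, u002–u010, (16.1) (tex L4404–L4449).
  [cite: Zhang2022LandauSiegel, §16 p.89 (u010)]
-/

noncomputable section

open Complex Real
open Literature.NumberTheory.LFunctions.Zhang2022.Skeleton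
open Literature.NumberTheory.LFunctions.Zhang2022.Typed.Section16A

namespace Literature.NumberTheory.LFunctions.Zhang2022.Step16u010

open Literature.NumberTheory.LFunctions.Zhang2022

/-! ## Size lemmas (`ε = e^{−c𝓛¹⁰}` against constants, `#Ψ₁` and `𝔓`) -/

/-- `L₀ ≤ log D` once `D ≥ ⌈exp L₀⌉₊`. [folklore] -/
private theorem le_ell_of_ceil_exp_le {L₀ : ℝ} {D : ℕ} (hD : ⌈Real.exp L₀⌉₊ ≤ D) : L₀ ≤ ell D := by
  have h : Real.exp L₀ ≤ D := le_trans (Nat.le_ceil _) (by exact_mod_cast hD)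
  exact (Real.le_log_iff_exp_le (lt_of_lt_of_le (Real.exp_pos _) h)).mpr h

/-- Zhang's negligible `ε = exp{−c𝓛¹⁰}` times any constant is eventually below any `η > 0`
(adapted from the tree's `Section8aStatements`). [cite: Zhang2022LandauSiegel, §4 p.19, tex L1062] -/
private theorem exp_neg_eventually_le {c : ℝ} (hc : 0 < c) (C η : ℝ) (hη : 0 < η) :
    ∃ D₀ : ℕ, ∀ D : ℕ, D₀ ≤ D → C * Real.exp (-c * ell D ^ 10) ≤ η := by
  refine ⟨⌈Real.exp (max 1 ((|C| + 1) / (c * η)))⌉₊, fun D hD => ?_⟩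
  have hℓ : max 1 ((|C| + 1) / (c * η)) ≤ ell D := le_ell_of_ceil_exp_le hD
  have hℓ1 : 1 ≤ ell D := le_trans (le_max_left _ _) hℓ
  have hℓ2 : (|C| + 1) / (c * η) ≤ ell D := le_trans (le_max_right _ _) hℓ
  have hℓ10 : ell D ≤ ell D ^ 10 := by
    calc ell D = ell D ^ 1 := (pow_one _).symm
      _ ≤ ell D ^ 10 := pow_le_pow_right₀ hℓ1 (by norm_num)
  have hE := Real.add_one_le_exp (c * ell D ^ 10)
  have hCle : |C| + 1 ≤ ell D * (c * η) := (div_le_iff₀ (by positivity)).mp hℓ2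
  have hEpos : 0 < Real.exp (c * ell D ^ 10) := Real.exp_pos _
  have hmono : η * c * ell D ≤ η * c * ell D ^ 10 := mul_le_mul_of_nonneg_left hℓ10 (by positivity)
  rw [neg_mul, Real.exp_neg, ← div_eq_mul_inv, div_le_iff₀ hEpos]
  calc C ≤ |C| := le_abs_self C
    _ ≤ η * c * ell D - 1 := by linarith
    _ ≤ η * (c * ell D ^ 10) := by linarith
    _ ≤ η * Real.exp (c * ell D ^ 10) := mul_le_mul_of_nonneg_left (by linarith) hη.le

/-- **`𝔓 ≥ 1` for large `D`** ((2.9): `𝔓 = (1 + O(𝓛⁻⁶⁸))P²𝓛⁻⁷⁷`, the tree's `frakP_bounds`; adapted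
from the tree's `Section8aStatements`). [cite: Zhang2022LandauSiegel, §2 (2.9) p.4] -/
private theorem one_le_frakP_eventually : ∃ D₀ : ℕ, ∀ D : ℕ, D₀ ≤ D → 1 ≤ frakP D := by
  obtain ⟨D₀, h⟩ := frakP_bounds
  refine ⟨max D₀ ⌈Real.exp 7⌉₊, fun D hD => ?_⟩
  have hD₀ : D₀ ≤ D := le_trans (le_max_left _ _) hD
  have hL7 : (7 : ℝ) ≤ Real.log D := by
    have := le_ell_of_ceil_exp_le (le_trans (le_max_right _ _) hD); rwa [ell] at this
  set L := Real.log D with hL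
  set M := Real.exp (L ^ 9) ^ 2 * (L ^ 77)⁻¹ with hM
  have hL0 : 0 < L := by linarith
  have hL77 : 0 < L ^ 77 := by positivity
  have hb := abs_le.mp (h D hD₀)
  have hL68 : 6 ≤ L ^ 68 := by
    calc (6 : ℝ) ≤ 7 ^ 1 := by norm_num
      _ ≤ L ^ 1 := by rw [pow_one, pow_one]; exact hL7
      _ ≤ L ^ 68 := pow_le_pow_right₀ (by linarith) (by norm_num)
  have hsmall : 3 * (L ^ 68)⁻¹ ≤ 1 / 2 := by
    rw [inv_eq_one_div, mul_one_div, div_le_iff₀ (by positivity)]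
    linarith
  have hL4 : (2401 : ℝ) ≤ L ^ 4 := by
    have := pow_le_pow_left₀ (by norm_num : (0 : ℝ) ≤ 7) hL7 4
    linarith [show (7 : ℝ) ^ 4 = 2401 by norm_num]
  have key : 2 * L ^ 77 ≤ Real.exp (L ^ 9) ^ 2 := by
    have h1 : (2 * L ^ 9) ^ 9 / (Nat.factorial 9 : ℝ) ≤ Real.exp (2 * L ^ 9) :=
      Real.pow_div_factorial_le_exp (2 * L ^ 9) (by positivity) 9
    have h2 : Real.exp (L ^ 9) ^ 2 = Real.exp (2 * L ^ 9) := by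
      rw [← Real.exp_nat_mul]; norm_num
    have h3 : (Nat.factorial 9 : ℝ) = 362880 := by norm_num [Nat.factorial]
    rw [h2]
    refine le_trans ?_ h1
    rw [h3, le_div_iff₀ (by norm_num)]
    calc 2 * L ^ 77 * 362880 = 725760 * L ^ 77 := by ring
      _ ≤ 512 * L ^ 4 * L ^ 77 := by nlinarith
      _ = (2 * L ^ 9) ^ 9 := by ring
  have hM2 : 2 ≤ M := by
    rw [hM, ← div_eq_mul_inv, le_div_iff₀ hL77]
    exact key
  nlinarith [hb.1, hsmall, hM2, mul_nonneg (by linarith : (0:ℝ) ≤ 1 / 2 - 3 * (L ^ 68)⁻¹)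
    (by linarith : (0:ℝ) ≤ M)]

/-- **`#Ψ₁·e^{−c𝓛¹⁰} ≪ e^{−(c/2)𝓛¹⁰}`**, in the form `4P²·(Ce^{−c𝓛¹⁰}) ≤ 4|C|·e^{−(c/2)𝓛¹⁰}` once
`𝓛 ≥ 4/c` (`P² = e^{2𝓛⁹}`, `2𝓛⁹ ≤ (c/2)𝓛¹⁰`). [cite: Zhang2022LandauSiegel, §2 (2.9) p.4] -/
private theorem four_bigP_sq_mul_exp_le {c : ℝ} (hc : 0 < c) {C : ℝ} (hC : 0 ≤ C) {D : ℕ}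
    (hℓ : 4 / c ≤ ell D) (hℓ1 : 1 ≤ ell D) :
    4 * bigP D ^ 2 * (C * Real.exp (-c * ell D ^ 10)) ≤ 4 * C * Real.exp (-(c / 2) * ell D ^ 10) := by
  have hℓ0 : 0 < ell D := by linarith
  have hP2 : bigP D ^ 2 = Real.exp (2 * ell D ^ 9) := by
    rw [bigP, ← Real.exp_nat_mul]; norm_num
  have hkey : 2 * ell D ^ 9 + -c * ell D ^ 10 ≤ -(c / 2) * ell D ^ 10 := by
    have h4 : 4 ≤ c * ell D := by rw [div_le_iff₀ hc] at hℓ; linarith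
    have h9 : 0 < ell D ^ 9 := pow_pos hℓ0 9
    have : ell D ^ 10 = ell D ^ 9 * ell D := by ring
    rw [this]; nlinarith
  calc 4 * bigP D ^ 2 * (C * Real.exp (-c * ell D ^ 10))
      = 4 * C * Real.exp (2 * ell D ^ 9 + -c * ell D ^ 10) := by rw [hP2, Real.exp_add]; ring
    _ ≤ 4 * C * Real.exp (-(c / 2) * ell D ^ 10) :=
        mul_le_mul_of_nonneg_left (Real.exp_le_exp.mpr hkey) (by positivity)

/-- Monotonicity in the exponent: `Ce^{−c𝓛¹⁰} ≤ |C|e^{−m𝓛¹⁰}` for `m ≤ c` (`𝓛 ≥ 0`). [folklore] -/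
private theorem mul_exp_le_abs_mul_exp {C c m : ℝ} (hmc : m ≤ c) (D : ℕ) :
    C * Real.exp (-c * ell D ^ 10) ≤ |C| * Real.exp (-m * ell D ^ 10) := by
  have hℓ : 0 ≤ ell D ^ 10 := pow_nonneg (Real.log_natCast_nonneg D) _
  have hexp : Real.exp (-c * ell D ^ 10) ≤ Real.exp (-m * ell D ^ 10) :=
    Real.exp_le_exp.mpr (by nlinarith)
  calc C * Real.exp (-c * ell D ^ 10) ≤ |C| * Real.exp (-c * ell D ^ 10) :=
        mul_le_mul_of_nonneg_right (le_abs_self C) (Real.exp_pos _).le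
    _ ≤ |C| * Real.exp (-m * ell D ^ 10) := mul_le_mul_of_nonneg_left hexp (abs_nonneg C)

/-! ## u005 from u002 and u004 -/

variable (c' : ℝ)

/-- **u005 ⇐ u002 + u004** ("Hence `Φ₂ = Σ_{ψ∈Ψ₁}(p_ψt₀)^{β₁}I₃⁺(ψ) + O(ε)`"): drop the `I₃⁻` terms, each
`≪ e^{−c𝓛¹⁰}` by u004, over `#Ψ₁ ≤ 𝔓 ≤ 4P² = 4e^{2𝓛⁹}` characters with `|(p_ψt₀)^{β₁}| = 1`; the total
is `≪ e^{−(c/2)𝓛¹⁰}`. Kernel edge. [cite: Zhang2022LandauSiegel, §16 p.89 (u005)] -/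
theorem step16_u005_of (h2 : Step16_u002 c') (h4 : Step16_u004 c') : Step16_u005 c' := by
  classical
  obtain ⟨c₁, hc₁, C₁, D₁, h₁⟩ := h2
  obtain ⟨c₂, hc₂, C₂, D₂, h₂⟩ := h4
  obtain ⟨D₃, hfrakP⟩ := Step8u016.frakP_le_eventually
  obtain ⟨D₄, hD₄f⟩ := Skeleton.exists_forall_le_ell (max 3 (4 / c₂))
  set m : ℝ := min c₁ (c₂ / 2) with hm
  have hm0 : 0 < m := lt_min hc₁ (by linarith)
  have hm1 : m ≤ c₁ := min_le_left _ _
  have hm2 : m ≤ c₂ / 2 := min_le_right _ _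
  refine ⟨m, hm0, |C₁| + 4 * |C₂|, max (max D₁ D₂) (max D₃ D₄), fun D _ χ hD hq hp hA => ?_⟩
  have hD₁ : D₁ ≤ D := le_trans (le_trans (le_max_left _ _) (le_max_left _ _)) hD
  have hD₂ : D₂ ≤ D := le_trans (le_trans (le_max_right _ _) (le_max_left _ _)) hD
  have hD₃ : D₃ ≤ D := le_trans (le_trans (le_max_left _ _) (le_max_right _ _)) hD
  have hD₄ : D₄ ≤ D := le_trans (le_trans (le_max_right _ _) (le_max_right _ _)) hD
  have hℓM := hD₄f D hD₄
  have hℓ3 : 3 ≤ ell D := le_trans (le_max_left _ _) hℓM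
  have hℓc : 4 / c₂ ≤ ell D := le_trans (le_max_right _ _) hℓM
  have hℓ1 : 1 ≤ ell D := by linarith
  obtain ⟨-, -, ht01, -, -⟩ := Step8u016.window_sizes hℓ3
  have ht0D : 0 < t0 D := by linarith
  have e₁ := h₁ D χ hD₁ hq hp hA
  have e₂ := h₂ D χ hD₂ hq hp hA
  set S : Finset (Chr D) := finsetOf (PsiOne χ) with hS
  -- the `I₃⁻`-part is negligible
  have hper : ∀ x ∈ S, ‖(((x.p : ℝ) * t0 D : ℝ) : ℂ) ^ beta1 c' D * I3pm c' χ x (-alpha D)‖ ≤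
      |C₂| * Real.exp (-c₂ * ell D ^ 10) := by
    intro x hx
    rw [norm_mul, norm_cpow_beta1 c' x ht0D, one_mul]
    exact (e₂ x (mem_of_mem_finsetOf hx)).trans
      (mul_le_mul_of_nonneg_right (le_abs_self _) (Real.exp_pos _).le)
  have hX : 0 ≤ |C₂| * Real.exp (-c₂ * ell D ^ 10) := by positivity
  have hminus : ‖∑ x ∈ S, (((x.p : ℝ) * t0 D : ℝ) : ℂ) ^ beta1 c' D * I3pm c' χ x (-alpha D)‖ ≤
      4 * |C₂| * Real.exp (-m * ell D ^ 10) := by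
    calc ‖∑ x ∈ S, (((x.p : ℝ) * t0 D : ℝ) : ℂ) ^ beta1 c' D * I3pm c' χ x (-alpha D)‖
        ≤ ∑ x ∈ S, ‖(((x.p : ℝ) * t0 D : ℝ) : ℂ) ^ beta1 c' D * I3pm c' χ x (-alpha D)‖ :=
          norm_sum_le _ _
      _ ≤ ∑ x ∈ S, |C₂| * Real.exp (-c₂ * ell D ^ 10) := Finset.sum_le_sum hper
      _ = S.card * (|C₂| * Real.exp (-c₂ * ell D ^ 10)) := by rw [Finset.sum_const, nsmul_eq_mul]
      _ ≤ 4 * bigP D ^ 2 * (|C₂| * Real.exp (-c₂ * ell D ^ 10)) := by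
          refine mul_le_mul_of_nonneg_right ?_ hX
          exact (Ded81Edge.card_finsetOf_psiOne_le_frakP χ).trans (hfrakP D hD₃ hℓ1)
      _ ≤ 4 * |C₂| * Real.exp (-(c₂ / 2) * ell D ^ 10) :=
          four_bigP_sq_mul_exp_le hc₂ (abs_nonneg C₂) hℓc hℓ1
      _ ≤ 4 * |C₂| * Real.exp (-m * ell D ^ 10) := by
          refine mul_le_mul_of_nonneg_left (Real.exp_le_exp.mpr ?_) (by positivity)
          have h10 : 0 ≤ ell D ^ 10 := pow_nonneg (by linarith) 10
          exact mul_le_mul_of_nonneg_right (neg_le_neg hm2) h10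
  -- the `I₃⁺`-part: the u002 remainder
  have hplus : ‖Phi2 c' χ - ∑ x ∈ S, (((x.p : ℝ) * t0 D : ℝ) : ℂ) ^ beta1 c' D *
      (I3pm c' χ x (alpha D) - I3pm c' χ x (-alpha D))‖ ≤ |C₁| * Real.exp (-m * ell D ^ 10) :=
    e₁.trans (mul_exp_le_abs_mul_exp hm1 D)
  -- assembly
  have hsplit : Phi2 c' χ - ∑ x ∈ S, (((x.p : ℝ) * t0 D : ℝ) : ℂ) ^ beta1 c' D * I3pm c' χ x (alpha D) =
      (Phi2 c' χ - ∑ x ∈ S, (((x.p : ℝ) * t0 D : ℝ) : ℂ) ^ beta1 c' D *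
        (I3pm c' χ x (alpha D) - I3pm c' χ x (-alpha D))) -
        ∑ x ∈ S, (((x.p : ℝ) * t0 D : ℝ) : ℂ) ^ beta1 c' D * I3pm c' χ x (-alpha D) := by
    rw [sub_sub, ← Finset.sum_add_distrib]
    congr 1
    refine Finset.sum_congr rfl fun x _ => ?_
    ring
  rw [hsplit]
  calc ‖(Phi2 c' χ - ∑ x ∈ S, (((x.p : ℝ) * t0 D : ℝ) : ℂ) ^ beta1 c' D *
          (I3pm c' χ x (alpha D) - I3pm c' χ x (-alpha D))) -
        ∑ x ∈ S, (((x.p : ℝ) * t0 D : ℝ) : ℂ) ^ beta1 c' D * I3pm c' χ x (-alpha D)‖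
      ≤ ‖Phi2 c' χ - ∑ x ∈ S, (((x.p : ℝ) * t0 D : ℝ) : ℂ) ^ beta1 c' D *
          (I3pm c' χ x (alpha D) - I3pm c' χ x (-alpha D))‖ +
        ‖∑ x ∈ S, (((x.p : ℝ) * t0 D : ℝ) : ℂ) ^ beta1 c' D * I3pm c' χ x (-alpha D)‖ :=
        norm_sub_le _ _
    _ ≤ |C₁| * Real.exp (-m * ell D ^ 10) + 4 * |C₂| * Real.exp (-m * ell D ^ 10) :=
        add_le_add hplus hminus
    _ = (|C₁| + 4 * |C₂|) * Real.exp (-m * ell D ^ 10) := by ring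

/-! ## u010 from u005 and the move `𝔍(α) → 𝔍(1)` -/

/-- **u010 ⇐ u005 + Proposition 2.2 (i)**: `Φ₂ = Σ_{ψ∈Ψ₁}(p_ψt₀)^{β₁}I₃⁺(ψ) + O(ε)` (u005) and
`Σ_{ψ∈Ψ₁}(p_ψt₀)^{β₁}I₃⁺(ψ) = Θ₂(β₁,𝐤₂*,𝐚₂*) + O(ε)` (the move `𝔍(α) → 𝔍(1)` under Prop. 2.2 (i) plus the
exact rewriting on `𝔍(1)`, tree `Step16u010.sum_I3plus_sub_Theta2_le_of`) give `Φ₂ = Θ₂ + o(𝔓)` (indeed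
`+ O(ε)`; `𝔓 ≥ 1`). Kernel edge. [cite: Zhang2022LandauSiegel, §16 p.89 (16.1), (u010)] -/
theorem step16_u010_of_u005 (h22 : Prop22i) (h5 : Step16_u005 c') : Step16_u010 c' := by
  classical
  intro ε hε
  obtain ⟨c₅, hc₅, C₅, D₅, h₅⟩ := h5
  obtain ⟨c₆, hc₆, C₆, D₆, h₆⟩ := sum_I3plus_sub_Theta2_le_of c' h22
  obtain ⟨D₇, hD₇f⟩ := exp_neg_eventually_le hc₅ C₅ (ε / 2) (by positivity)
  obtain ⟨D₈, hD₈f⟩ := exp_neg_eventually_le hc₆ C₆ (ε / 2) (by positivity)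
  obtain ⟨D₉, hD₉f⟩ := one_le_frakP_eventually
  refine ⟨max (max D₅ D₆) (max (max D₇ D₈) D₉), fun D _ χ hD hq hp hA => ?_⟩
  have hD₅ : D₅ ≤ D := le_trans (le_trans (le_max_left _ _) (le_max_left _ _)) hD
  have hD₆ : D₆ ≤ D := le_trans (le_trans (le_max_right _ _) (le_max_left _ _)) hD
  have hD₇ : D₇ ≤ D :=
    le_trans (le_trans (le_trans (le_max_left _ _) (le_max_left _ _)) (le_max_right _ _)) hD
  have hD₈ : D₈ ≤ D :=
    le_trans (le_trans (le_trans (le_max_right _ _) (le_max_left _ _)) (le_max_right _ _)) hD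
  have hD₉ : D₉ ≤ D := le_trans (le_trans (le_max_right _ _) (le_max_right _ _)) hD
  have e₅ := h₅ D χ hD₅ hq hp hA
  have e₆ := h₆ D χ hD₆ hq hp
  have hP := hD₉f D hD₉
  set A : ℂ := ∑ x ∈ finsetOf (PsiOne χ), (((x.p : ℝ) * t0 D : ℝ) : ℂ) ^ beta1 c' D *
    I3pm c' χ x (alpha D) with hA_def
  calc ‖Phi2 c' χ - Theta2 χ (beta1 c' D) (kappa2Star c' χ) fun n => gTilde16 c' D n‖
      = ‖(Phi2 c' χ - A) + (A - Theta2 χ (beta1 c' D) (kappa2Star c' χ) fun n => gTilde16 c' D n)‖ := by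
        congr 1; ring
    _ ≤ ‖Phi2 c' χ - A‖ + ‖A - Theta2 χ (beta1 c' D) (kappa2Star c' χ) fun n => gTilde16 c' D n‖ :=
        norm_add_le _ _
    _ ≤ C₅ * Real.exp (-c₅ * ell D ^ 10) + C₆ * Real.exp (-c₆ * ell D ^ 10) := add_le_add e₅ e₆
    _ ≤ ε / 2 + ε / 2 := add_le_add (hD₇f D hD₇) (hD₈f D hD₈)
    _ = ε * 1 := by ring
    _ ≤ ε * frakP D := mul_le_mul_of_nonneg_left hP hε.le

/-- **`Z22:§16.u010` modulo u002, u004 and Proposition 2.2 (i)** (all three by name).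
[cite: Zhang2022LandauSiegel, §16 p.89 (u010)] -/
theorem step16_u010_of_parts (h22 : Prop22i) (h2 : Step16_u002 c') (h4 : Step16_u004 c') :
    Step16_u010 c' :=
  step16_u010_of_u005 c' h22 (step16_u005_of c' h2 h4)

/-- **`Z22:§16.u010` modulo its two residual displayed steps u002 and u004** — Proposition 2.2 (i) is
the tree theorem `Skeleton.prop22i_holds`. The leaf `Typed.Section16A.Step16_u010 c′` of
`theorem1_of_leaves_v19` thus reduces to the residue step u002 (the §16 twin of (8.1)/(15.3)) and the
estimate `I₃⁻(ψ) ≪ ε` (u004). [cite: Zhang2022LandauSiegel, §16 p.89 (u010)] -/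
theorem step16_u010_of (h2 : Step16_u002 c') (h4 : Step16_u004 c') : Step16_u010 c' :=
  step16_u010_of_parts c' prop22i_holds h2 h4

end Literature.NumberTheory.LFunctions.Zhang2022.Step16u010
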